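import Summits.CriticalPhenomena.PercolationContinuityZ3.Theorems.PercNearOneGluingNoHeavyQuantFarHairyCycleLeSix
import Summits.CriticalPhenomena.PercolationContinuityZ3.Theorems.PercNearOneGluingNoHeavyQuantFarSunCertSevenThree
import Summits.CriticalPhenomena.PercolationContinuityZ3.Theorems.PercNearOneGluingNoHeavyQuantFarSunCertSevenTwo
import HarnessLib

/-!
# FAR beyond trees: `Quant.FarRelayRow` on EVERY hairy cycle with at most SEVEN pendant relays

builds on p205010 (kernel theorem, internal audit signed; external expert review pending)

Support file (`--supports stmt-CriticalPhenomena-4575`), seat `prim-cert-1` (gen 18); sequel of `…QuantFarHairyCycleLeSix` (`K ≤ 6`): adds the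
Kronecker-checked sun certificates `TwoCopy.farp_sun7_j1`, `farp_sun7_j2`, `farp_sun7_j3` (`…QuantFarSunCertSeven` / `…SevenTwo` / `…SevenThree`, `m = 15`) through the segment reduction
`HairyCycle.farp_of_sun`.  Result: `HairyCycle.farRelayRow_hairyCycle_le_seven` — for every hairy cycle (`IsHairyCycle`, `2 ≤ K ≤ 7` hairs), every
weight function supported on it, every layer `j` and `t`: `2j < Σ_k P(c_0 ↔ t_k)` and `P(c_0 ↮ t_k) ≤ t` (all `k`) imply `P(#{k : c_0 ↔ t_k} ≤ j) ≤ t`.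
No sorries; standard axioms.
[cite: KozmaNitzan2024, Lemma 2 (p. 6), Conjecture 3 (p. 15)] (context).
-/

noncomputable section

namespace Summit.CriticalPhenomena.PercolationContinuityZ3.Theorems.HairyCycle

open Finset MeasureTheory
open Literature.Probability.Percolation Literature.Probability.LatticeModels
open Summit.CriticalPhenomena.PercolationContinuityZ3.Theorems.AdditiveGluing.Negative.Cert
open Summit.CriticalPhenomena.PercolationContinuityZ3.Theorems.TwoCopy
open scoped Classical

/-- `sunEs 7` is the certificate file's `sun7_es`. [this work] -/
theorem sunEs_seven : sunEs 7 = sun7_es := by decide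

/-- `sunAs 7` is the certificate file's `sun7_As`. [this work] -/
theorem sunAs_seven : sunAs 7 = sun7_As := by decide

/-- The sun hypothesis of the segment reduction for `K = 7`, every layer. [this work] -/
theorem farp_sun_seven (j : ℕ) (q : Sym2 (Fin (2 * 7 + 1)) → unitInterval) (hq : VanishesOff q (sunEs 7)) :
    FARp q ((Finset.range 7).image (sunTip 7)) (sunCyc 7 0) j := by
  rw [← sunAs_toFinset, sunAs_seven, sunCyc_zero]
  rw [sunEs_seven] at hq
  rcases Nat.lt_or_ge j 1 with hj | hj
  · have : j = 0 := by omega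
    subst this
    exact FARp.zero q _ _
  rcases Nat.lt_or_ge j 2 with hj2 | hj2
  · have : j = 1 := by omega
    subst this
    exact farp_sun7_j1 q hq
  rcases Nat.lt_or_ge j 3 with hj3 | hj3
  · have : j = 2 := by omega
    subst this
    exact farp_sun7_j2 q hq
  rcases Nat.lt_or_ge j 4 with hj4 | hj4
  · have : j = 3 := by omega
    subst this
    exact farp_sun7_j3 q hq
  · exact FARp.of_card_le q _ _ j ((List.toFinset_card_le _).trans (by simp [sun7_As]; omega))

variable {n : ℕ} {L : ℕ} {cyc : ℕ → Fin n} {K : ℕ} {base : ℕ → ℕ} {tip : ℕ → Fin n}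

/-- **FAR on every hairy cycle with seven hairs, every layer.** [this work] -/
theorem farp_hairyCycle_seven (H : IsHairyCycle L cyc 7 base tip) (w : Sym2 (Fin n) → unitInterval)
    (hsupp : ∀ e : Sym2 (Fin n), ¬ e.IsDiag → w e ≠ 0 →
      (∃ i, i < L ∧ e = cycE L cyc i) ∨ (∃ k, k < 7 ∧ e = hairE cyc base tip k)) (j : ℕ) :
    FARp w ((Finset.range 7).image tip) (cyc 0) j :=
  farp_of_sun H j (farp_sun_seven j) w hsupp

/-- **`Quant.FarRelayRow` ON EVERY HAIRY CYCLE WITH AT MOST SEVEN HAIRS** (the row's body for these supports and relay sets): for a hairy cycle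
with `2 ≤ K ≤ 7` hairs, every weight function whose non-loop support lies on the cycle and hair pairs, every layer `j` and every `t`:
`2j < Σ_{k<K} P(c_0 ↔ t_k)` and `P(c_0 ↮ t_k) ≤ t` for all `k < K` imply `P(#{k < K : c_0 ↔ t_k} ≤ j) ≤ t`. [this work] -/
theorem farRelayRow_hairyCycle_le_seven (H : IsHairyCycle L cyc K base tip) (hK : K ≤ 7) (w : Sym2 (Fin n) → unitInterval)
    (hsupp : ∀ e : Sym2 (Fin n), ¬ e.IsDiag → w e ≠ 0 →
      (∃ i, i < L ∧ e = cycE L cyc i) ∨ (∃ k, k < K ∧ e = hairE cyc base tip k))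
    (j : ℕ) (t : ℝ)
    (hEN : (2 * j : ℝ) < ∑ a ∈ (Finset.range K).image tip, (prodBernoulli w).real (openConn (cyc 0) a))
    (hcut : ∀ a ∈ (Finset.range K).image tip, (prodBernoulli w).real (openConn (cyc 0) a)ᶜ ≤ t) :
    (prodBernoulli w).real {ω : BondConfig (Fin n) |
      (((Finset.range K).image tip).filter fun a => ω ∈ openConn (cyc 0) a).card ≤ j} ≤ t := by
  rcases Nat.lt_or_ge K 7 with h7 | h7
  · exact farRelayRow_hairyCycle_le_six H (by omega) w hsupp j t hEN hcut
  · have hK' : K = 7 := by omega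
    subst hK'
    exact farp_hairyCycle_seven H w hsupp j hEN t hcut

end Summit.CriticalPhenomena.PercolationContinuityZ3.Theorems.HairyCycle

end
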